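import Summits.BirchSwinnertonDyer.Rank1Residual.X10.SelfTwistPartialAgreement
import Summits.BirchSwinnertonDyer.Rank1Residual.X10.SelfTwistVisibleGoodAtThreeRecordsA
import Summits.BirchSwinnertonDyer.Rank1Residual.X10.SelfTwistVisibleGoodAtThreeRecordsB
import Summits.BirchSwinnertonDyer.Rank1Residual.X10.SelfTwistVisibleGoodAtThreeRecordsC
import Summits.BirchSwinnertonDyer.Rank1Residual.GaloisImage.PadicTwistClassDecider
import HarnessLib

/-!
# N2 (X10b @ 3): SELF-TWIST visibility records UNCONDITIONAL at `3` (x10 GEN 22's partial agreement, no `hMR`) —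
# `327184dt1` (twin `327184cx1`) and `395641f1` (twin `395641g1`, `#Ш_an = 36`); + §X the generic-`p` socket (for X9 = N3 at `p ∈ {5,7}`)
# (cell `b2b-bsdres`, unit `b2b-bsdres-x10` = N2 class lead, GEN 22; per-pair RECORDS, close nothing)

HONEST FRAMING (cell `b2b-bsdres`, run/shared/lean/b2b/bsd-rank1-residual/, verbatim in every
file): the goal of the cell is to DELETE the COMBINATION-SHAPED residual classes of the
Birch–Swinnerton-Dyer formula for ALL analytic-rank `≤ 1` elliptic curves over `ℚ` — "full BSD
formula for every rank `≤ 1` curve in class `C`" assembled STRICTLY from published theorems — so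
that the rank-`≤ 1` remainder becomes exactly the CONSTRUCTION-SHAPED classes, which are TYPED
(missing-input `Prop`s), NOT attempted. This is not "finishing BSD". Class X10b (= N2) stays
CONSTRUCTION-SHAPED (NEEDS `X_A3`); this file holds PER-PAIR RECORDS of the LOWER half only; nothing is
booked; no mark / label / tier / count is changed. Theorems only (no definition, no named fact of ours,
no `sorry`).

## What

The seven ANOMALOUS N2 self-twist Ш-cells (`40898d 55696l 55696n 110224f 183184b 327184dt 395641f`; x10
GEN 21 `SELF-TWIST-LAW.md`, GEN 22 `X10/SelfTwistVisibleGoodAtThree{,RecordsA,B,C}.lean`) re-derived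
WITHOUT the Mazur–Rubin named fact `hMR`: by x10 GEN 22's UNCONDITIONAL partial agreement
`SelfTwist.relIndex_map_selmerLocalKer_le_card_quot_of_hasGoodReductionAt`
(`X10/SelfTwistPartialAgreement.lean`: at a both-good place `ι_v(θ) ≤ #(𝓞_v/p)`, Milne *ADT* I 3.8 DISCHARGED in
the tree) the place `3` costs `3` and the twin's rank `2` pays for it (`1·3 < 9`; socket
`exists_sha_ne_zero_three_of_congr_goodAtThree_rankTwo[_mult]_of_primeList`).  Per record:
`∃ c ∈ Ш(E), c ≠ 0, 3c = 0`; `3² ∣ #Ш(E)[3^∞]` (`hCT`); the typed LOWER binder `MissingLowerBoundAt W 3`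
(`hq`).  Every local binder IN THE KERNEL, re-using the numerals and TamLocal certificates landed with the
kind-(v) records (x10 GEN 12 point counts, `noroot3_frob_*`, `tamLocal_check_*`, F2d minimality).
BINDERS LEFT (displayed, EVIDENCE columns — nothing booked): `hCT`, `hGZK`, `hr : r_an(E) = 0` (Cremona),
`θ : E′[3] ≃ E[3]` with `hθ` (the self-twist congruence; EVIDENCE: cc-eng-2 KO-certified
`class-closure/N2/CONG-certified-eng2.tsv`, kit j123296), `hrank : 2 ≤ rank E′(ℚ)` (Cremona `allgens`),
`hq` (`#Ш_an`); `hU2` (Tate uniformisation) for `40898d1` only (place `2` of kind (iii)).  NO `hMR`.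

References: [MilneADT2006] I Prop. 3.8, Lemma 2.9, Lemma 3.3; [CremonaMazur2000] §3; [AgasheStein2002]
Thm. 3.1; [Mazur1978] Prop. 6.3 (1); [SilvermanATAEC1994] IV.9.4, V.5.3–5.4; [SilvermanAEC2009] VII.5.1,
X.4.14; [Kraus1989] Prop. 2; [Cremona2006] Table 1.
-/

set_option autoImplicit false

noncomputable section

open scoped Classical NumberField
open IsDedekindDomain NumberField WeierstrassCurve Rat.HeightOneSpectrum
  Literature.NumberTheory.EllipticCurves Literature.NumberTheory.EllipticCurves.ModularForms
  Literature.NumberTheory.EllipticCurves.Rank1Residual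
  Literature.NumberTheory.EllipticCurves.Rank1Residual.Typed
  Literature.NumberTheory.GaloisRepresentations
  Summit.BirchSwinnertonDyer.BirchSwinnertonDyer.Rank1Residual.IntModel
  Summit.BirchSwinnertonDyer.BirchSwinnertonDyer.Rank1Residual.X11RankOne
  Summit.BirchSwinnertonDyer.BirchSwinnertonDyer.Rank2Observatory
  Summit.BirchSwinnertonDyer.BirchSwinnertonDyer.Rank2Observatory.Tam
  Summit.BirchSwinnertonDyer.Rank1Residual.GaloisImage
  Summit.BirchSwinnertonDyer.Rank1Residual.GaloisImage.LocalTorsion3At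
  Summit.BirchSwinnertonDyer.Rank1Residual.Additive
  Summit.BirchSwinnertonDyer.Rank1Residual.X11b

namespace Summit.BirchSwinnertonDyer.Rank1Residual.X10.SelfTwist

/-! ### Record `327184dt1`, unconditional at `3` (twin `327184cx1`; `N = 327184 = 2⁴·11²·13²`, `d* = 13`, `#Ш_an(E) = 9`) -/
/-- **SELF-TWIST VISIBILITY RECORD, UNCONDITIONAL AT `3` (closes nothing, moves no mark): a non-zero
`3`-torsion element of `Ш(E/ℚ)` for `E = 327184dt1` from its rank-2 self-twist `E′ = 327184cx1 = E ⊗ χ_{13}`**,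
both curves GOOD ORDINARY and ANOMALOUS at `3` — the place `3` costs `ι₃(θ) ≤ #(ℤ₃/3) = 3 < 9 ≤ 3^rank` by x10
GEN 22's partial agreement `SelfTwist.relIndex_map_selmerLocalKer_le_card_quot_of_hasGoodReductionAt` (NO named
fact; Milne I.3.8 discharged in the tree); the other places of `S` = places over `[2, 3, 11, 13]` are additive for
`E′` with `E′(ℚ_ℓ)[3] = 0` (kind (i), TamLocal certificates in the kernel: `2` (Kodaira I*ₙ, value set {2,4}), `11` (Kodaira I*₀, value set {1,2,4}), `13` (type III, c = 2)); `E[3]` irreducible from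
the Frobenius witness `ℓ = 7` (`#Ẽ(𝔽_{7}) = 5`); needs `rank E′ ≥ 2` (Cremona: `2`). Supersedes the
kind-(v) record `exists_sha_three_selfTwist_v327184dt1` (conditional on Mazur–Rubin `hMR`, rank `≥ 1`).
[cite: MilneADT2006, Ch. I Prop. 3.8 and Lemma 2.9] [cite: CremonaMazur2000, §3 and Table 1]
[cite: Mazur1978, §6 Prop. 6.3 (1) (p. 153)] [cite: Cremona2006, Table 1 (labels 327184dt1, 327184cx1)] -/
theorem exists_sha_three_selfTwist_uncond_v327184dt1
    (hGZK : rank_eq_analyticRank_of_analyticRank_le_one)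
    (W : WeierstrassCurve ℚ) [W.IsElliptic] [W.IsGloballyMinimal]
    (hI : integralModelInt W = ⟨0, 1, 0, 974736, (-1134484012)⟩) (hr : W.analyticRank = 0)
    (W' : WeierstrassCurve ℚ) (hW' : W' = ⟨0, 1, 0, 5768, (-514604)⟩) [W'.IsElliptic]
    (θ : geomTorsion W' ((3 : ℕ) : ℤ) ≃+ geomTorsion W ((3 : ℕ) : ℤ))
    (hθ : ∀ (σ : Field.absoluteGaloisGroup ℚ) (P : geomTorsion W' ((3 : ℕ) : ℤ)), θ (σ • P) = σ • θ P)
    (hrank : 2 ≤ W'.mordellWeilRank) :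
    ∃ c : W.sha, c ≠ 0 ∧ 3 • c = 0 := by
  haveI : Fact (Nat.Prime 3) := ⟨Nat.prime_three⟩
  haveI : Fact (Nat.Prime 2) := ⟨by norm_num⟩
  haveI : Fact (Nat.Prime 7) := ⟨by norm_num⟩
  haveI : Fact (Nat.Prime 11) := ⟨by norm_num⟩
  haveI : Fact (Nat.Prime 13) := ⟨by norm_num⟩
  -- the row `327184dt1`: `E(ℚ)` finite of order prime to `3`
  have hfin : Finite W.toAffine.Point := finite_point_of_analyticRank_eq_zero W hGZK hr
  have hirr : W.HasIrreducibleModPGaloisRep 3 :=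
    hasIrreducibleModPGaloisRep_of_intModel_of_noroot hI 3 7 (by norm_num) (by decide +kernel)
      Summit.BirchSwinnertonDyer.Rank1Residual.X10.card_t327184dt1_7 noroot3_frob_v322624k1_7
  have hcop : (Nat.card W.toAffine.Point).Coprime 3 := coprime_natCard_point_of_irr W 3 hirr
  have hE : (⟨0, 1, 0, 974736, (-1134484012)⟩ : WeierstrassCurve ℤ).map (Int.castRingHom ℚ) = W := by
    rw [IntModelTam.eq_baseChange_of_integralModelInt hI]; rfl
  -- the partner `327184cx1`: globally minimal, integral model
  have hM' : W'.IsGloballyMinimal := by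
    rw [hW']
    exact Summit.BirchSwinnertonDyer.Rank1Residual.X10.isGloballyMinimal_of_krausCriterion_bounded₃ 0 1 0 5768 (-514604)
      (by decide +kernel) (by decide +kernel) (by decide +kernel) (by decide +kernel)
  have hI' : integralModelInt W' = ⟨0, 1, 0, 5768, (-514604)⟩ := by
    subst hW'; exact integralModelInt_eq_of_map_eq _ (map_mk_int 0 1 0 5768 (-514604))
  have hF : (⟨0, 1, 0, 5768, (-514604)⟩ : WeierstrassCurve ℤ).map (Int.castRingHom ℚ) = W' := by
    rw [hW']; exact map_mk_int 0 1 0 5768 (-514604)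
  -- prime support of the two discriminants
  have hΔE : ∀ q : ℕ, q.Prime → (q : ℤ) ∣ (⟨0, 1, 0, 974736, (-1134484012)⟩ : WeierstrassCurve ℤ).Δ → q ∈ [2, 3, 11, 13] :=
    X11b.forall_mem_of_natAbs_eq_prod_pow [2, 3, 11, 13] [15, 0, 6, 9]
      (by intro q hq; simp only [List.mem_cons, List.mem_nil_iff, or_false] at hq; rcases hq with rfl | rfl | rfl | rfl <;> norm_num)
      (by decide +kernel)
  have hΔF : ∀ q : ℕ, q.Prime → (q : ℤ) ∣ (⟨0, 1, 0, 5768, (-514604)⟩ : WeierstrassCurve ℤ).Δ → q ∈ [2, 3, 11, 13] :=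
    X11b.forall_mem_of_natAbs_eq_prod_pow [2, 3, 11, 13] [15, 0, 6, 3]
      (by intro q hq; simp only [List.mem_cons, List.mem_nil_iff, or_false] at hq; rcases hq with rfl | rfl | rfl | rfl <;> norm_num)
      (by decide +kernel)
  refine exists_sha_ne_zero_three_of_congr_goodAtThree_rankTwo_of_primeList W W' θ hθ hE hF [2, 3, 11, 13] (by simp)
    hΔE hΔF
    (by decide +kernel) (by decide +kernel) hfin hcop hrank (fun v hvL hv3 ↦ ?_)
  simp only [List.mem_cons, List.mem_nil_iff, or_false] at hvL
  rcases hvL with h2 | h3 | h11 | h13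
  · -- `v = 2`: additive Kodaira I*ₙ, value set {2,4}
    exact LocalTorsionAway.natCard_ker_nsmul_adicCompletion_eq_one_of_intModel_of_additive_tamLocal_forall hI' 2 3
      (by norm_num) h2 (by decide) (by decide) (E := ⟨2, 1, 5, 0, 22, 1, 48, 15, 71, 3, 4⟩) rfl
      tamLocal_check_327184cx1_2 (by decide)
  · exact absurd h3 hv3
  · -- `v = 11`: additive Kodaira I*₀, value set {1,2,4}
    exact LocalTorsionAway.natCard_ker_nsmul_adicCompletion_eq_one_of_intModel_of_additive_tamLocal_forall hI' 11 3
      (by norm_num) h11 (by decide) (by decide) (E := ⟨11, 3, 5, 0, 7, 0, 0, 6, 6, 0, 4⟩) rfl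
      tamLocal_check_327184cx1_11 (by decide)
  · -- `v = 13`: additive type III, `c = 2`
    exact LocalTorsionAway.natCard_ker_nsmul_adicCompletion_eq_one_of_intModel_of_additive hI' 13 3 (by norm_num) h13
      (by decide) (by decide)
      (IntModelTam.localTamagawaNumber_padic_eq_of_intModel_of_tamLocal hI' 13 (E := ⟨13, 3, 4, 0, 4, 0, 0, 3, 3, 2, 2⟩)
        rfl tamLocal_check_327184cx1_13 (c := 2) (by decide)) (by norm_num)

/-- **`3² ∣ #Ш(327184dt1)[3^∞]`** from the visible element (unconditional at `3`) and the Cassels–Tate parity (`hCT`).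
[cite: SilvermanAEC2009, Thm. X.4.14] [cite: MilneADT2006, Ch. I Prop. 3.8] -/
theorem sq_dvd_card_sha_three_selfTwist_uncond_v327184dt1
    (hCT : exists_casselsTate_pairing (K := ℚ))
    (hGZK : rank_eq_analyticRank_of_analyticRank_le_one)
    (W : WeierstrassCurve ℚ) [W.IsElliptic] [W.IsGloballyMinimal]
    (hI : integralModelInt W = ⟨0, 1, 0, 974736, (-1134484012)⟩) (hr : W.analyticRank = 0)
    (W' : WeierstrassCurve ℚ) (hW' : W' = ⟨0, 1, 0, 5768, (-514604)⟩) [W'.IsElliptic]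
    (θ : geomTorsion W' ((3 : ℕ) : ℤ) ≃+ geomTorsion W ((3 : ℕ) : ℤ))
    (hθ : ∀ (σ : Field.absoluteGaloisGroup ℚ) (P : geomTorsion W' ((3 : ℕ) : ℤ)), θ (σ • P) = σ • θ P)
    (hrank : 2 ≤ W'.mordellWeilRank) :
    3 ^ 2 ∣ Nat.card (AddCommGroup.primaryComponent W.sha 3) := by
  haveI : Finite W.sha := (hGZK W (by rw [hr]; exact zero_le_one)).2
  exact Visible.sq_dvd_card_sha_three_of_exists_sha_torsion hCT W
    (exists_sha_three_selfTwist_uncond_v327184dt1 hGZK W hI hr W' hW' θ hθ hrank)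

/-- **The typed LOWER binder `MissingLowerBoundAt E 3` for `327184dt1`** (`ord₃ #Ш_an ≤ ord₃ #Ш`) from the visible
`3`-torsion element, the Cassels–Tate squareness and the analytic datum `#Ш_an = 9` (`hq`, Cremona `allbsd`;
evidence binder). Conditional on `hCT` only at this step. [cite: SilvermanAEC2009, Thm. X.4.14] [cite: Cremona2006, Table 1 (label 327184dt1)] -/
theorem missingLowerBoundAt_three_selfTwist_uncond_v327184dt1
    (hCT : exists_casselsTate_pairing (K := ℚ))
    (hGZK : rank_eq_analyticRank_of_analyticRank_le_one)
    (W : WeierstrassCurve ℚ) [W.IsElliptic] [W.IsGloballyMinimal]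
    (hI : integralModelInt W = ⟨0, 1, 0, 974736, (-1134484012)⟩) (hr : W.analyticRank = 0)
    {q : ℚ} (hq : shaAn W = (q : ℂ)) (hv : padicValRat 3 q ≤ 2)
    (W' : WeierstrassCurve ℚ) (hW' : W' = ⟨0, 1, 0, 5768, (-514604)⟩) [W'.IsElliptic]
    (θ : geomTorsion W' ((3 : ℕ) : ℤ) ≃+ geomTorsion W ((3 : ℕ) : ℤ))
    (hθ : ∀ (σ : Field.absoluteGaloisGroup ℚ) (P : geomTorsion W' ((3 : ℕ) : ℤ)), θ (σ • P) = σ • θ P)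
    (hrank : 2 ≤ W'.mordellWeilRank) :
    haveI : Fact (Nat.Prime 3) := ⟨Nat.prime_three⟩
    MissingLowerBoundAt W 3 := by
  haveI : Fact (Nat.Prime 3) := ⟨Nat.prime_three⟩
  have hvis := exists_sha_three_selfTwist_uncond_v327184dt1 hGZK W hI hr W' hW' θ hθ hrank
  exact missingLowerBoundAt_of_casselsTate_of_pow_dvd W 3 hCT (hGZK W (by rw [hr]; exact zero_le_one)).2 hq
    (k := 1) (by simpa using hv) (by simpa using dvd_shaOrder_of_exists_torsion W 3 hvis)

/-! ### Record `395641f1`, unconditional at `3` (twin `395641g1`; `N = 395641 = 17²·37²`, `d* = 37`, `#Ш_an(E) = 36`) -/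
/-- **SELF-TWIST VISIBILITY RECORD, UNCONDITIONAL AT `3` (closes nothing, moves no mark): a non-zero
`3`-torsion element of `Ш(E/ℚ)` for `E = 395641f1` from its rank-2 self-twist `E′ = 395641g1 = E ⊗ χ_{37}`**,
both curves GOOD ORDINARY and ANOMALOUS at `3` — the place `3` costs `ι₃(θ) ≤ #(ℤ₃/3) = 3 < 9 ≤ 3^rank` by x10
GEN 22's partial agreement `SelfTwist.relIndex_map_selmerLocalKer_le_card_quot_of_hasGoodReductionAt` (NO named
fact; Milne I.3.8 discharged in the tree); the other places of `S` = places over `[3, 17, 37]` are additive for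
`E′` with `E′(ℚ_ℓ)[3] = 0` (kind (i), TamLocal certificates in the kernel: `17` (Kodaira I*ₙ, value set {2,4}), `37` (type III, c = 2)); `E[3]` irreducible from
the Frobenius witness `ℓ = 13` (`#Ẽ(𝔽_{13}) = 20`); needs `rank E′ ≥ 2` (Cremona: `2`). Supersedes the
kind-(v) record `exists_sha_three_selfTwist_v395641f1` (conditional on Mazur–Rubin `hMR`, rank `≥ 1`).
[cite: MilneADT2006, Ch. I Prop. 3.8 and Lemma 2.9] [cite: CremonaMazur2000, §3 and Table 1]
[cite: Mazur1978, §6 Prop. 6.3 (1) (p. 153)] [cite: Cremona2006, Table 1 (labels 395641f1, 395641g1)] -/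
theorem exists_sha_three_selfTwist_uncond_v395641f1
    (hGZK : rank_eq_analyticRank_of_analyticRank_le_one)
    (W : WeierstrassCurve ℚ) [W.IsElliptic] [W.IsGloballyMinimal]
    (hI : integralModelInt W = ⟨0, 1, 1, (-24934614623), (-1515437094749663)⟩) (hr : W.analyticRank = 0)
    (W' : WeierstrassCurve ℚ) (hW' : W' = ⟨0, 1, 1, (-18213743), (-29923919810)⟩) [W'.IsElliptic]
    (θ : geomTorsion W' ((3 : ℕ) : ℤ) ≃+ geomTorsion W ((3 : ℕ) : ℤ))
    (hθ : ∀ (σ : Field.absoluteGaloisGroup ℚ) (P : geomTorsion W' ((3 : ℕ) : ℤ)), θ (σ • P) = σ • θ P)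
    (hrank : 2 ≤ W'.mordellWeilRank) :
    ∃ c : W.sha, c ≠ 0 ∧ 3 • c = 0 := by
  haveI : Fact (Nat.Prime 3) := ⟨Nat.prime_three⟩
  haveI : Fact (Nat.Prime 13) := ⟨by norm_num⟩
  haveI : Fact (Nat.Prime 17) := ⟨by norm_num⟩
  haveI : Fact (Nat.Prime 37) := ⟨by norm_num⟩
  -- the row `395641f1`: `E(ℚ)` finite of order prime to `3`
  have hfin : Finite W.toAffine.Point := finite_point_of_analyticRank_eq_zero W hGZK hr
  have hirr : W.HasIrreducibleModPGaloisRep 3 :=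
    hasIrreducibleModPGaloisRep_of_intModel_of_noroot hI 3 13 (by norm_num) (by decide +kernel)
      card_t395641f1_13 noroot3_frob_13_20
  have hcop : (Nat.card W.toAffine.Point).Coprime 3 := coprime_natCard_point_of_irr W 3 hirr
  have hE : (⟨0, 1, 1, (-24934614623), (-1515437094749663)⟩ : WeierstrassCurve ℤ).map (Int.castRingHom ℚ) = W := by
    rw [IntModelTam.eq_baseChange_of_integralModelInt hI]; rfl
  -- the partner `395641g1`: globally minimal, integral model
  have hM' : W'.IsGloballyMinimal := by
    rw [hW']
    exact isGloballyMinimal_of_krausCriterion_bounded₂ 0 1 1 (-18213743) (-29923919810)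
      (by decide +kernel) (by decide +kernel) (by decide +kernel)
  have hI' : integralModelInt W' = ⟨0, 1, 1, (-18213743), (-29923919810)⟩ := by
    subst hW'; exact integralModelInt_eq_of_map_eq _ (map_mk_int 0 1 1 (-18213743) (-29923919810))
  have hF : (⟨0, 1, 1, (-18213743), (-29923919810)⟩ : WeierstrassCurve ℤ).map (Int.castRingHom ℚ) = W' := by
    rw [hW']; exact map_mk_int 0 1 1 (-18213743) (-29923919810)
  -- prime support of the two discriminants
  have hΔE : ∀ q : ℕ, q.Prime → (q : ℤ) ∣ (⟨0, 1, 1, (-24934614623), (-1515437094749663)⟩ : WeierstrassCurve ℤ).Δ → q ∈ [3, 17, 37] :=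
    X11b.forall_mem_of_natAbs_eq_prod_pow [3, 17, 37] [0, 12, 9]
      (by intro q hq; simp only [List.mem_cons, List.mem_nil_iff, or_false] at hq; rcases hq with rfl | rfl | rfl <;> norm_num)
      (by decide +kernel)
  have hΔF : ∀ q : ℕ, q.Prime → (q : ℤ) ∣ (⟨0, 1, 1, (-18213743), (-29923919810)⟩ : WeierstrassCurve ℤ).Δ → q ∈ [3, 17, 37] :=
    X11b.forall_mem_of_natAbs_eq_prod_pow [3, 17, 37] [0, 12, 3]
      (by intro q hq; simp only [List.mem_cons, List.mem_nil_iff, or_false] at hq; rcases hq with rfl | rfl | rfl <;> norm_num)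
      (by decide +kernel)
  refine exists_sha_ne_zero_three_of_congr_goodAtThree_rankTwo_of_primeList W W' θ hθ hE hF [3, 17, 37] (by simp)
    hΔE hΔF
    (by decide +kernel) (by decide +kernel) hfin hcop hrank (fun v hvL hv3 ↦ ?_)
  simp only [List.mem_cons, List.mem_nil_iff, or_false] at hvL
  rcases hvL with h3 | h17 | h37
  · exact absurd h3 hv3
  · -- `v = 17`: additive Kodaira I*ₙ, value set {2,4}
    exact LocalTorsionAway.natCard_ker_nsmul_adicCompletion_eq_one_of_intModel_of_additive_tamLocal_forall hI' 17 3
      (by norm_num) h17 (by decide) (by decide) (E := ⟨17, 4, 5, 0, 40896, 0, 709928, 12, 72, 2, 4⟩) rfl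
      tamLocal_check_395641g1_17 (by decide)
  · -- `v = 37`: additive type III, `c = 2`
    exact LocalTorsionAway.natCard_ker_nsmul_adicCompletion_eq_one_of_intModel_of_additive hI' 37 3 (by norm_num) h37
      (by decide) (by decide)
      (IntModelTam.localTamagawaNumber_padic_eq_of_intModel_of_tamLocal hI' 37 (E := ⟨37, 6, 4, 0, 12, 0, 18, 3, 3, 2, 2⟩)
        rfl tamLocal_check_395641g1_37 (c := 2) (by decide)) (by norm_num)

/-- **`3² ∣ #Ш(395641f1)[3^∞]`** from the visible element (unconditional at `3`) and the Cassels–Tate parity (`hCT`).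
[cite: SilvermanAEC2009, Thm. X.4.14] [cite: MilneADT2006, Ch. I Prop. 3.8] -/
theorem sq_dvd_card_sha_three_selfTwist_uncond_v395641f1
    (hCT : exists_casselsTate_pairing (K := ℚ))
    (hGZK : rank_eq_analyticRank_of_analyticRank_le_one)
    (W : WeierstrassCurve ℚ) [W.IsElliptic] [W.IsGloballyMinimal]
    (hI : integralModelInt W = ⟨0, 1, 1, (-24934614623), (-1515437094749663)⟩) (hr : W.analyticRank = 0)
    (W' : WeierstrassCurve ℚ) (hW' : W' = ⟨0, 1, 1, (-18213743), (-29923919810)⟩) [W'.IsElliptic]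
    (θ : geomTorsion W' ((3 : ℕ) : ℤ) ≃+ geomTorsion W ((3 : ℕ) : ℤ))
    (hθ : ∀ (σ : Field.absoluteGaloisGroup ℚ) (P : geomTorsion W' ((3 : ℕ) : ℤ)), θ (σ • P) = σ • θ P)
    (hrank : 2 ≤ W'.mordellWeilRank) :
    3 ^ 2 ∣ Nat.card (AddCommGroup.primaryComponent W.sha 3) := by
  haveI : Finite W.sha := (hGZK W (by rw [hr]; exact zero_le_one)).2
  exact Visible.sq_dvd_card_sha_three_of_exists_sha_torsion hCT W
    (exists_sha_three_selfTwist_uncond_v395641f1 hGZK W hI hr W' hW' θ hθ hrank)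

/-- **The typed LOWER binder `MissingLowerBoundAt E 3` for `395641f1`** (`ord₃ #Ш_an ≤ ord₃ #Ш`) from the visible
`3`-torsion element, the Cassels–Tate squareness and the analytic datum `#Ш_an = 36` (`hq`, Cremona `allbsd`;
evidence binder). Conditional on `hCT` only at this step. [cite: SilvermanAEC2009, Thm. X.4.14] [cite: Cremona2006, Table 1 (label 395641f1)] -/
theorem missingLowerBoundAt_three_selfTwist_uncond_v395641f1
    (hCT : exists_casselsTate_pairing (K := ℚ))
    (hGZK : rank_eq_analyticRank_of_analyticRank_le_one)
    (W : WeierstrassCurve ℚ) [W.IsElliptic] [W.IsGloballyMinimal]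
    (hI : integralModelInt W = ⟨0, 1, 1, (-24934614623), (-1515437094749663)⟩) (hr : W.analyticRank = 0)
    {q : ℚ} (hq : shaAn W = (q : ℂ)) (hv : padicValRat 3 q ≤ 2)
    (W' : WeierstrassCurve ℚ) (hW' : W' = ⟨0, 1, 1, (-18213743), (-29923919810)⟩) [W'.IsElliptic]
    (θ : geomTorsion W' ((3 : ℕ) : ℤ) ≃+ geomTorsion W ((3 : ℕ) : ℤ))
    (hθ : ∀ (σ : Field.absoluteGaloisGroup ℚ) (P : geomTorsion W' ((3 : ℕ) : ℤ)), θ (σ • P) = σ • θ P)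
    (hrank : 2 ≤ W'.mordellWeilRank) :
    haveI : Fact (Nat.Prime 3) := ⟨Nat.prime_three⟩
    MissingLowerBoundAt W 3 := by
  haveI : Fact (Nat.Prime 3) := ⟨Nat.prime_three⟩
  have hvis := exists_sha_three_selfTwist_uncond_v395641f1 hGZK W hI hr W' hW' θ hθ hrank
  exact missingLowerBoundAt_of_casselsTate_of_pow_dvd W 3 hCT (hGZK W (by rw [hr]; exact zero_le_one)).2 hq
    (k := 1) (by simpa using hv) (by simpa using dvd_shaOrder_of_exists_torsion W 3 hvis)


/-! ### §X. The same socket for an arbitrary odd prime `p` (for X9 = N3 at `p ∈ {5, 7}`: anomalous `pNs` twins) -/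

/-- The finite place of `ℚ` over a prime `p` has `#(ℤ_p/p) = p`. [folklore] -/
theorem natCard_quot_prime_eq (p : ℕ) [hp : Fact p.Prime] (v : HeightOneSpectrum (𝓞 ℚ))
    (hv : (Rat.HeightOneSpectrum.primesEquiv v : ℕ) = p) :
    Nat.card (v.adicCompletionIntegers ℚ ⧸ Ideal.span {((p : ℕ) : v.adicCompletionIntegers ℚ)}) = p := by
  have hv_of : ∀ w : HeightOneSpectrum (𝓞 ℚ), ((p : ℕ) : 𝓞 ℚ) ∈ w.asIdeal → w = v := by
    intro w hw
    apply (Rat.HeightOneSpectrum.primesEquiv (R := 𝓞 ℚ)).injective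
    exact Subtype.ext ((Rat.HeightOneSpectrum.primesEquiv_eq_of_natCast_mem w hp.out hw).trans hv.symm)
  have h := WeierstrassCurve.prod_natCard_quot_adicCompletionIntegers (K := ℚ) (p := p) ({v} : Finset _)
    (fun w hw h3 ↦ hw (by rw [Finset.mem_singleton]; exact hv_of w h3))
  rw [Finset.prod_singleton, Module.finrank_self, pow_one] at h
  exact_mod_cast h

/-- **The UNCONDITIONAL socket over `ℚ` at an arbitrary odd prime `p`** (the shape X9 = N3 needs at
`p ∈ {5, 7}`): integer models `E₀`, `F₀` with discriminants on a prime list `L ∋ p`, `p ∤ Δ(E₀)Δ(F₀)` (both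
GOOD at `p`: the place costs `ι_p(θ) ≤ #(ℤ_p/p) = p` by §2 of `X10/SelfTwistPartialAgreement.lean`, no named
fact), `θ : E′[p] ⥲ E[p]` `Γ_ℚ`-equivariant, `E(ℚ)` finite of order prime to `p`, `rank E′(ℚ) ≥ 2`
(`1·p < p² ≤ [E′(ℚ):pE′(ℚ)]`), `#E′(ℚ_ℓ)[p] = 1` at every other listed place ⇒ `Ш(E)[p] ≠ 0`.
[cite: CremonaMazur2000, §3 and Table 1] [cite: AgasheStein2002, Thm. 3.1 and §3.5]
[cite: MilneADT2006, Ch. I Prop. 3.8 and Lemma 2.9] -/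
theorem exists_sha_ne_zero_of_congr_goodAtP_rankTwo_of_primeList (p : ℕ) [hp : Fact p.Prime] (hp2 : p ≠ 2)
    (W W' : WeierstrassCurve ℚ) [W.IsElliptic] [W'.IsElliptic]
    (θ : geomTorsion W' (p : ℤ) ≃+ geomTorsion W (p : ℤ))
    (hθ : ∀ (σ : Field.absoluteGaloisGroup ℚ) (P : geomTorsion W' (p : ℤ)), θ (σ • P) = σ • θ P)
    {E₀ F₀ : WeierstrassCurve ℤ} (hE : E₀.map (Int.castRingHom ℚ) = W)
    (hF : F₀.map (Int.castRingHom ℚ) = W') (L : List ℕ) (hpL : p ∈ L)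
    (hΔE : ∀ q : ℕ, q.Prime → (q : ℤ) ∣ E₀.Δ → q ∈ L)
    (hΔF : ∀ q : ℕ, q.Prime → (q : ℤ) ∣ F₀.Δ → q ∈ L)
    (hpE : ¬ ((p : ℕ) : ℤ) ∣ E₀.Δ) (hpF : ¬ ((p : ℕ) : ℤ) ∣ F₀.Δ)
    (hfin : Finite W.toAffine.Point) (hcop : (Nat.card W.toAffine.Point).Coprime p)
    (hrank : 2 ≤ W'.mordellWeilRank)
    (hplaces : ∀ v : HeightOneSpectrum (𝓞 ℚ), (Rat.HeightOneSpectrum.primesEquiv v : ℕ) ∈ L →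
      (Rat.HeightOneSpectrum.primesEquiv v : ℕ) ≠ p →
      Nat.card (nsmulAddMonoidHom p :
        (W'.baseChange (v.adicCompletion ℚ)).toAffine.Point →+ _).ker = 1) :
    ∃ c : W.sha, c ≠ 0 ∧ p • c = 0 := by
  have hpp : p.Prime := hp.out
  haveI := hfin
  set e := Rat.HeightOneSpectrum.primesEquiv (R := 𝓞 ℚ) with he
  set S : Finset (HeightOneSpectrum (𝓞 ℚ)) :=
    (L.filterMap fun q ↦ if h : q.Prime then some (e.symm ⟨q, h⟩) else none).toFinset with hSdef
  have hmemS : ∀ v : HeightOneSpectrum (𝓞 ℚ), v ∈ S ↔ (e v : ℕ) ∈ L := by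
    intro v
    rw [hSdef, List.mem_toFinset, List.mem_filterMap]
    constructor
    · rintro ⟨q, hq, hqv⟩
      by_cases hqp : q.Prime
      · rw [dif_pos hqp, Option.some.injEq] at hqv
        rw [← hqv, Equiv.apply_symm_apply]
        exact hq
      · rw [dif_neg hqp] at hqv
        exact absurd hqv (by simp)
    · intro hv
      refine ⟨(e v : ℕ), hv, ?_⟩
      rw [dif_pos (e v).2]
      simp
  set v₀ : HeightOneSpectrum (𝓞 ℚ) := e.symm ⟨p, hpp⟩ with hv₀def
  have hv₀ : (e v₀ : ℕ) = p := by rw [hv₀def, Equiv.apply_symm_apply]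
  have hv₀S : v₀ ∈ S := (hmemS v₀).mpr (by rw [hv₀]; exact hpL)
  refine exists_sha_ne_zero_of_congr_of_relIndex_lt W W' hp2 θ hθ S (fun v hvS ↦ ?_) ?_
  · have hvL : (e v : ℕ) ∉ L := fun h ↦ hvS ((hmemS v).mpr h)
    have hq : (e v : ℕ).Prime := (e v).2
    refine ⟨?_, ?_, fun hpv ↦ hvL ?_⟩
    · rw [← hE]
      exact hasGoodReductionAt_map_of_not_dvd E₀ v fun h ↦ hvL (hΔE _ hq h)
    · rw [← hF]
      exact hasGoodReductionAt_map_of_not_dvd F₀ v fun h ↦ hvL (hΔF _ hq h)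
    · rw [he, Rat.HeightOneSpectrum.primesEquiv_eq_of_natCast_mem v hpp hpv]
      exact hpL
  · have hbound : ∀ v ∈ S, (selmerLocalKer W (v.adicCompletion ℚ) (p : ℤ)).relIndex
        ((selmerLocalKer W' (v.adicCompletion ℚ) (p : ℤ)).map (h1Equiv θ hθ).toAddMonoidHom) ≤
        (if v = v₀ then p else 1) := by
      intro v hvS
      have hvL : (e v : ℕ) ∈ L := (hmemS v).mp hvS
      by_cases hv : v = v₀
      · rw [if_pos hv]
        have hvp : (e v : ℕ) = p := by rw [hv]; exact hv₀
        have hgood : W.HasGoodReductionAt v := by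
          rw [← hE]
          exact hasGoodReductionAt_map_of_not_dvd E₀ v (by rw [← he, hvp]; exact hpE)
        have hgood' : W'.HasGoodReductionAt v := by
          rw [← hF]
          exact hasGoodReductionAt_map_of_not_dvd F₀ v (by rw [← he, hvp]; exact hpF)
        have h := relIndex_map_selmerLocalKer_le_card_quot_of_hasGoodReductionAt W W' θ hθ hgood hgood'
        rwa [natCard_quot_prime_eq p v (by rw [← he]; exact hvp)] at h
      · rw [if_neg hv]
        have hvp : (e v : ℕ) ≠ p := fun h ↦ hv (by
          rw [hv₀def, Equiv.eq_symm_apply]; exact Subtype.ext h)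
        have hpv : ((p : ℕ) : 𝓞 ℚ) ∉ v.asIdeal := fun h ↦
          hvp (Rat.HeightOneSpectrum.primesEquiv_eq_of_natCast_mem v hpp h)
        exact (relIndex_map_selmerLocalKer_eq_one_of_card_torsion_eq_one W W' θ hθ hpv
          (hplaces v hvL hvp)).le
    have hprod : ∏ v ∈ S, (selmerLocalKer W (v.adicCompletion ℚ) (p : ℤ)).relIndex
        ((selmerLocalKer W' (v.adicCompletion ℚ) (p : ℤ)).map (h1Equiv θ hθ).toAddMonoidHom) ≤ p := by
      refine (Finset.prod_le_prod' hbound).trans ?_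
      rw [Finset.prod_ite_eq' S v₀ (fun _ ↦ p), if_pos hv₀S]
    have h1 := index_range_zsmul_eq_one_of_coprime (p := p) hcop
    have h2 := pow_mordellWeilRank_le_index_range_zsmul W' (n := p) hpp.ne_zero
    have hp9 : (1 : ℕ) * p < p ^ W'.mordellWeilRank := by
      rw [one_mul]
      calc p = p ^ 1 := (pow_one p).symm
        _ < p ^ 2 := Nat.pow_lt_pow_right hpp.one_lt (by norm_num)
        _ ≤ p ^ W'.mordellWeilRank := Nat.pow_le_pow_right hpp.pos hrank
    refine lt_of_le_of_lt (Nat.mul_le_mul (le_of_eq ?_) hprod) (lt_of_lt_of_le hp9 ?_)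
    · convert h1
    · convert h2

end Summit.BirchSwinnertonDyer.Rank1Residual.X10.SelfTwist

end
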